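import Literature.Geometry.Riemannian.SphericalCylinderEntropyHeatEquation
import Mathlib.Analysis.Calculus.ContDiff.Bounds
import Mathlib.Analysis.Normed.Operator.Prod
import Mathlib.Analysis.SpecialFunctions.Exponential
import HarnessLib

/-!
# All jets of the modes of the typed zonal heat kernel of `S⁴`, with Gaussian majorants

Topic `Literature/Geometry/Riemannian`; continuation of `SphericalCylinderEntropyGegenbauerODE.lean`
and `SphericalCylinderEntropyHeatEquation.lean`.  The typed zonal kernel of route
`SmoothPoincare4/CylinderEntropy` is `zonal τ s = ∑_k wt k τ · gegen k s` with
`wt k τ = e^{-k(k+3)τ} (2k+3)/3` and `gegen k = C_k^{(3/2)}` an explicit polynomial of degree `k`.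
To prove that `(τ, s) ↦ zonal τ s` is jointly `C^∞` on `(0, ∞) × ℝ` (sequel
`SphericalCylinderEntropyZonalSmooth.lean`, through the tree's localized `contDiff_tsum`,
`Literature.Analysis.Calculus.contDiffAt_tsum_of_norm_iteratedFDeriv_le`) one needs summable bounds
for ALL iterated derivatives of the modes `(τ, s) ↦ wt k τ · gegen k s` on boxes
`[τ₁, ∞) × [-R, R]`.  Proved here (everything; no facts, no definitions):

* `iteratedDeriv_gegen` — the explicit `i`-th derivative of the finite sum,
  `C_k^{(i)}(s) = ∑_l a_l (∏_{j<i} (k-2l-j)) 2^i (2s)^{k-2l-i}`;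
* `abs_iteratedDeriv_gegen_le`, `abs_iteratedDeriv_gegen_le_factorial` —
  `|C_k^{(i)}(s)| ≤ (k+1)² (2k)^i (8R)^k ≤ i! (k+1)² (64R)^k` on `|s| ≤ R`, `R ≥ 1`
  (`(2k)^i ≤ i! e^{2k} ≤ i! 8^k`);
* `iteratedDeriv_wt`, `abs_iteratedDeriv_wt_le`, `contDiff_wt` — `wt^{(i)} = (-k(k+3))^i wt`,
  `|wt^{(i)}(τ)| ≤ (4·4^k)^i e^{-k(k+3)τ₁} (2k+3)/3` for `τ ≥ τ₁`;
* `norm_iteratedFDeriv_comp_fst_le`, `norm_iteratedFDeriv_comp_snd_le` — derivatives of a function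
  of one coordinate on `ℝ × ℝ`;
* `norm_iteratedFDeriv_mode_le` — **the Gaussian majorant of all jets of the modes**:
  `‖D^m [(τ, s) ↦ wt k τ · C_k(s)] (y)‖ ≤ 8^m m! · e^{-k(k+3)τ₁} (4^m · 512 R)^k` for `y.1 ≥ τ₁`,
  `|y.2| ≤ R` (Leibniz bound `norm_iteratedFDeriv_mul_le`), summable in `k` for every `m` by
  `summable_exp_mul_pow_of_pos`.

## References
* NIST Digital Library of Mathematical Functions, §18.5.10.
* R. S. Hamilton, *Monotonicity formulas for parabolic flows on manifolds*, Comm. Anal. Geom. 1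
  (1993), 127–137.
-/

noncomputable section

open scoped BigOperators Topology ContDiff
open Filter Set Finset Literature.Geometry.Riemannian

namespace Literature.Geometry.Riemannian.SphericalCylinderEntropy

/-! ### All derivatives of the typed Gegenbauer polynomials -/

/-- **The `i`-th derivative of `C_k^{(3/2)}`** as the term-wise derivative of the explicit sum:
`C_k^{(i)}(s) = ∑_l a_l (∏_{j<i} (k-2l-j)) 2^i (2s)^{k-2l-i}`. [folklore] -/
theorem iteratedDeriv_gegen (i k : ℕ) :
    iteratedDeriv i (gegen k) = fun s => ∑ l ∈ Finset.range (k / 2 + 1), (-1 : ℝ) ^ l *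
      (∏ j ∈ Finset.range (k - l), ((3 : ℝ) / 2 + (j : ℝ))) /
        (((l.factorial : ℕ) : ℝ) * (((k - 2 * l).factorial : ℕ) : ℝ)) *
      ((∏ j ∈ Finset.range i, ((k - 2 * l - j : ℕ) : ℝ)) * 2 ^ i * (2 * s) ^ (k - 2 * l - i)) := by
  induction i with
  | zero =>
    funext s
    simp [gegen]
  | succ i ih =>
    rw [iteratedDeriv_succ, ih]
    funext s
    refine (HasDerivAt.fun_sum fun l _ => ?_).deriv
    have h := (hasDerivAt_two_mul_pow (k - 2 * l - i) s).const_mul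
      ((-1 : ℝ) ^ l * (∏ j ∈ Finset.range (k - l), ((3 : ℝ) / 2 + (j : ℝ))) /
        (((l.factorial : ℕ) : ℝ) * (((k - 2 * l).factorial : ℕ) : ℝ)) *
        ((∏ j ∈ Finset.range i, ((k - 2 * l - j : ℕ) : ℝ)) * 2 ^ i))
    refine (h.congr_deriv ?_).congr_of_eventuallyEq (Filter.Eventually.of_forall fun x => by ring)
    rw [Finset.prod_range_succ, pow_succ, show k - 2 * l - i - 1 = k - 2 * l - (i + 1) by omega]
    ring

/-- The falling product `∏_{j<i} (k-2l-j)` is at most `k^i`. [folklore] -/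
theorem abs_prod_cast_sub_le (i k l : ℕ) :
    |∏ j ∈ Finset.range i, ((k - 2 * l - j : ℕ) : ℝ)| ≤ (k : ℝ) ^ i := by
  rw [abs_of_nonneg (Finset.prod_nonneg fun j _ => by positivity)]
  calc ∏ j ∈ Finset.range i, ((k - 2 * l - j : ℕ) : ℝ) ≤ ∏ _j ∈ Finset.range i, (k : ℝ) :=
        Finset.prod_le_prod (fun j _ => by positivity) fun j _ => by
          exact_mod_cast (Nat.sub_le _ j).trans (Nat.sub_le k (2 * l))
    _ = (k : ℝ) ^ i := by rw [Finset.prod_const, Finset.card_range]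

/-- **`|C_k^{(i)}(s)| ≤ (k+1)² (2k)^i (8R)^k` for `|s| ≤ R`, `R ≥ 1`.** [folklore] -/
theorem abs_iteratedDeriv_gegen_le (i k : ℕ) {R s : ℝ} (hR : 1 ≤ R) (hs : |s| ≤ R) :
    |iteratedDeriv i (gegen k) s| ≤ ((k : ℝ) + 1) ^ 2 * (2 * (k : ℝ)) ^ i * (8 * R) ^ k := by
  have h := abs_sum_gegenCoeff_mul_le k hR hs
    (fun l => (∏ j ∈ Finset.range i, ((k - 2 * l - j : ℕ) : ℝ)) * 2 ^ i)
    (fun l => k - 2 * l - i) (W := (2 * (k : ℝ)) ^ i) (by positivity)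
    (fun l _ => by
      rw [abs_mul, abs_pow, abs_two, mul_pow, mul_comm]
      exact mul_le_mul_of_nonneg_left (abs_prod_cast_sub_le i k l) (by positivity))
    (fun l _ => by omega)
  have h8 : (8 * R) ^ k = 4 ^ k * (2 * R) ^ k := by rw [← mul_pow]; ring
  rw [iteratedDeriv_gegen, h8]
  calc _ ≤ ((k : ℝ) + 1) ^ 2 * 4 ^ k * (2 * (k : ℝ)) ^ i * (2 * R) ^ k := h
    _ = _ := by ring

/-- `(2k)^i ≤ i! · 8^k` (`x^i / i! ≤ e^x` at `x = 2k`, `e² ≤ 8`). [folklore] -/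
theorem two_mul_pow_le_factorial_mul (k i : ℕ) :
    (2 * (k : ℝ)) ^ i ≤ (i.factorial : ℝ) * 8 ^ k := by
  have h := Real.pow_div_factorial_le_exp (2 * (k : ℝ)) (by positivity) i
  rw [div_le_iff₀ (by positivity)] at h
  have he2 : Real.exp 2 ≤ 8 := by
    have h1 : Real.exp 1 < 2.7182818286 := Real.exp_one_lt_d9
    have h2 : Real.exp 2 = Real.exp 1 ^ 2 := by rw [← Real.exp_nat_mul]; norm_num
    rw [h2]
    nlinarith [Real.exp_pos 1]
  have he : Real.exp (2 * (k : ℝ)) ≤ 8 ^ k := by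
    rw [show 2 * (k : ℝ) = (k : ℕ) * 2 by ring, Real.exp_nat_mul]
    exact pow_le_pow_left₀ (Real.exp_pos _).le he2 k
  calc (2 * (k : ℝ)) ^ i ≤ Real.exp (2 * (k : ℝ)) * (i.factorial : ℝ) := h
    _ ≤ 8 ^ k * (i.factorial : ℝ) := mul_le_mul_of_nonneg_right he (by positivity)
    _ = _ := mul_comm _ _

/-- **`|C_k^{(i)}(s)| ≤ i! (k+1)² (64R)^k` for `|s| ≤ R`, `R ≥ 1`.** [folklore] -/
theorem abs_iteratedDeriv_gegen_le_factorial (i k : ℕ) {R s : ℝ} (hR : 1 ≤ R) (hs : |s| ≤ R) :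
    |iteratedDeriv i (gegen k) s| ≤ (i.factorial : ℝ) * ((k : ℝ) + 1) ^ 2 * (64 * R) ^ k := by
  have h64 : (64 * R) ^ k = 8 ^ k * (8 * R) ^ k := by rw [← mul_pow]; ring
  rw [h64]
  calc |iteratedDeriv i (gegen k) s| ≤ ((k : ℝ) + 1) ^ 2 * (2 * (k : ℝ)) ^ i * (8 * R) ^ k :=
        abs_iteratedDeriv_gegen_le i k hR hs
    _ ≤ ((k : ℝ) + 1) ^ 2 * ((i.factorial : ℝ) * 8 ^ k) * (8 * R) ^ k := by
        gcongr
        exact two_mul_pow_le_factorial_mul k i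
    _ = _ := by ring

/-! ### All derivatives of the typed heat weights -/

/-- **`wt^{(i)} = (-k(k+3))^i · wt`.** [folklore] -/
theorem iteratedDeriv_wt (i k : ℕ) :
    iteratedDeriv i (wt k) = fun τ => (-((k : ℝ) * ((k : ℝ) + 3))) ^ i * wt k τ := by
  have h : wt k = fun τ => Real.exp (-((k : ℝ) * ((k : ℝ) + 3)) * τ) * ((2 * (k : ℝ) + 3) / 3) :=
    rfl
  rw [h]
  funext τ
  rw [iteratedDeriv_mul_const_field, iteratedDeriv_exp_const_mul]
  ring

/-- The heat weights are smooth. [folklore] -/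
theorem contDiff_wt (k : ℕ) {n : WithTop ℕ∞} : ContDiff ℝ n (wt k) := by
  have h : ContDiff ℝ ⊤ (wt k) := by
    unfold wt
    fun_prop
  exact h.of_le le_top

/-- The weight is non-increasing in the scale. [folklore] -/
theorem wt_le_of_le (k : ℕ) {τ₁ τ : ℝ} (h : τ₁ ≤ τ) : wt k τ ≤ wt k τ₁ := by
  unfold wt
  exact mul_le_mul_of_nonneg_right (exp_weight_antitone k h) (by positivity)

/-- **`|wt^{(i)}(τ)| ≤ (4·4^k)^i · wt k τ₁` for `τ ≥ τ₁`** (`k(k+3) ≤ 4·4^k`). [folklore] -/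
theorem abs_iteratedDeriv_wt_le (i k : ℕ) {τ₁ τ : ℝ} (h : τ₁ ≤ τ) :
    |iteratedDeriv i (wt k) τ| ≤ (4 * 4 ^ k) ^ i * wt k τ₁ := by
  rw [iteratedDeriv_wt]
  simp only []
  rw [abs_mul, abs_pow, abs_neg, abs_of_nonneg (by positivity : (0 : ℝ) ≤ (k : ℝ) * ((k : ℝ) + 3)),
    abs_of_pos (wt_pos k τ)]
  exact mul_le_mul (pow_le_pow_left₀ (by positivity) (cast_mul_add_three_le k) i)
    (wt_le_of_le k h) (wt_pos k τ).le (by positivity)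

/-! ### Functions of one coordinate on `ℝ × ℝ` -/

/-- Derivatives of `y ↦ f (y.1)` on `ℝ × ℝ` are bounded by those of `f`. [folklore] -/
theorem norm_iteratedFDeriv_comp_fst_le {f : ℝ → ℝ} (hf : ContDiff ℝ ∞ f) (i : ℕ) (y : ℝ × ℝ) :
    ‖iteratedFDeriv ℝ i (fun y : ℝ × ℝ => f y.1) y‖ ≤ ‖iteratedFDeriv ℝ i f y.1‖ := by
  have h := ContinuousLinearMap.iteratedFDeriv_comp_right (ContinuousLinearMap.fst ℝ ℝ ℝ) hf y
    (i := i) (by exact_mod_cast le_top)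
  have hcomp : (fun y : ℝ × ℝ => f y.1) = f ∘ ⇑(ContinuousLinearMap.fst ℝ ℝ ℝ) := rfl
  rw [hcomp, h]
  refine (ContinuousMultilinearMap.norm_compContinuousLinearMap_le _ _).trans ?_
  refine mul_le_of_le_one_right (norm_nonneg _) ?_
  exact Finset.prod_le_one (fun _ _ => norm_nonneg _) fun _ _ => ContinuousLinearMap.norm_fst_le ..

/-- Derivatives of `y ↦ g (y.2)` on `ℝ × ℝ` are bounded by those of `g`. [folklore] -/
theorem norm_iteratedFDeriv_comp_snd_le {g : ℝ → ℝ} (hg : ContDiff ℝ ∞ g) (i : ℕ) (y : ℝ × ℝ) :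
    ‖iteratedFDeriv ℝ i (fun y : ℝ × ℝ => g y.2) y‖ ≤ ‖iteratedFDeriv ℝ i g y.2‖ := by
  have h := ContinuousLinearMap.iteratedFDeriv_comp_right (ContinuousLinearMap.snd ℝ ℝ ℝ) hg y
    (i := i) (by exact_mod_cast le_top)
  have hcomp : (fun y : ℝ × ℝ => g y.2) = g ∘ ⇑(ContinuousLinearMap.snd ℝ ℝ ℝ) := rfl
  rw [hcomp, h]
  refine (ContinuousMultilinearMap.norm_compContinuousLinearMap_le _ _).trans ?_
  refine mul_le_of_le_one_right (norm_nonneg _) ?_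
  exact Finset.prod_le_one (fun _ _ => norm_nonneg _) fun _ _ => ContinuousLinearMap.norm_snd_le ..

/-! ### The Gaussian majorant of all jets of the modes -/

/-- The modes `(τ, s) ↦ wt k τ · C_k(s)` are smooth on `ℝ × ℝ`. [folklore] -/
theorem contDiff_mode (k : ℕ) {n : WithTop ℕ∞} :
    ContDiff ℝ n (fun y : ℝ × ℝ => wt k y.1 * gegen k y.2) :=
  ((contDiff_wt k).comp contDiff_fst).mul ((contDiff_gegen k).comp contDiff_snd)

/-- **Gaussian majorant of all jets of the modes**: for `y.1 ≥ τ₁`, `|y.2| ≤ R`, `R ≥ 1`,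
`‖D^m [(τ, s) ↦ wt k τ · C_k(s)] (y)‖ ≤ 8^m m! · wt k τ₁ (k+1)² (4^m · 64 R)^k`
(Leibniz: `∑_i (m choose i) (4·4^k)^i wt k τ₁ · (m-i)! (k+1)² (64R)^k`, `(4·4^k)^i ≤ 4^m (4^m)^k`,
`(m-i)! ≤ m!`, `∑ (m choose i) = 2^m`). [folklore] -/
theorem norm_iteratedFDeriv_mode_le (m k : ℕ) {τ₁ R : ℝ} (hR : 1 ≤ R) {y : ℝ × ℝ}
    (hy1 : τ₁ ≤ y.1) (hy2 : |y.2| ≤ R) :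
    ‖iteratedFDeriv ℝ m (fun y : ℝ × ℝ => wt k y.1 * gegen k y.2) y‖ ≤
      (8 ^ m * (m.factorial : ℝ)) * (wt k τ₁ * ((k : ℝ) + 1) ^ 2 * (4 ^ m * (64 * R)) ^ k) := by
  have hf : ContDiff ℝ ∞ (fun y : ℝ × ℝ => wt k y.1) := (contDiff_wt k).comp contDiff_fst
  have hg : ContDiff ℝ ∞ (fun y : ℝ × ℝ => gegen k y.2) := (contDiff_gegen k).comp contDiff_snd
  have hL := norm_iteratedFDeriv_mul_le hf hg y (n := m) (by exact_mod_cast le_top)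
  refine hL.trans ?_
  -- bound each term of the Leibniz sum
  have hA : (1 : ℝ) ≤ 4 * 4 ^ k := by
    have : (1 : ℝ) ≤ 4 ^ k := one_le_pow₀ (by norm_num)
    linarith
  have hterm : ∀ i ∈ Finset.range (m + 1),
      (m.choose i : ℝ) * ‖iteratedFDeriv ℝ i (fun y : ℝ × ℝ => wt k y.1) y‖ *
        ‖iteratedFDeriv ℝ (m - i) (fun y : ℝ × ℝ => gegen k y.2) y‖ ≤
      (m.choose i : ℝ) * ((4 * 4 ^ k) ^ m * wt k τ₁ *
        ((m.factorial : ℝ) * ((k : ℝ) + 1) ^ 2 * (64 * R) ^ k)) := by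
    intro i hi
    have him : i ≤ m := Nat.lt_succ_iff.1 (Finset.mem_range.1 hi)
    have h1 : ‖iteratedFDeriv ℝ i (fun y : ℝ × ℝ => wt k y.1) y‖ ≤ (4 * 4 ^ k) ^ m * wt k τ₁ := by
      refine (norm_iteratedFDeriv_comp_fst_le (contDiff_wt k) i y).trans ?_
      rw [norm_iteratedFDeriv_eq_norm_iteratedDeriv, Real.norm_eq_abs]
      refine (abs_iteratedDeriv_wt_le i k hy1).trans ?_
      exact mul_le_mul_of_nonneg_right (pow_le_pow_right₀ hA him) (wt_pos k τ₁).le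
    have h2 : ‖iteratedFDeriv ℝ (m - i) (fun y : ℝ × ℝ => gegen k y.2) y‖ ≤
        (m.factorial : ℝ) * ((k : ℝ) + 1) ^ 2 * (64 * R) ^ k := by
      refine (norm_iteratedFDeriv_comp_snd_le (contDiff_gegen k) (m - i) y).trans ?_
      rw [norm_iteratedFDeriv_eq_norm_iteratedDeriv, Real.norm_eq_abs]
      refine (abs_iteratedDeriv_gegen_le_factorial (m - i) k hR hy2).trans ?_
      have hfac : ((m - i).factorial : ℝ) ≤ (m.factorial : ℝ) := by
        exact_mod_cast Nat.factorial_le (Nat.sub_le m i)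
      have h0 : (0 : ℝ) ≤ ((k : ℝ) + 1) ^ 2 * (64 * R) ^ k := by positivity
      nlinarith
    rw [mul_assoc]
    refine mul_le_mul_of_nonneg_left ?_ (by positivity)
    exact mul_le_mul h1 h2 (norm_nonneg _) (mul_nonneg (by positivity) (wt_pos k τ₁).le)
  refine (Finset.sum_le_sum hterm).trans ?_
  rw [← Finset.sum_mul]
  have hchoose : ∑ i ∈ Finset.range (m + 1), (m.choose i : ℝ) = 2 ^ m := by
    have h := Nat.sum_range_choose m
    exact_mod_cast h
  rw [hchoose]
  -- compare `2^m (4·4^k)^m wt m! (k+1)² (64R)^k` with `8^m m! wt (k+1)² (4^m 64 R)^k`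
  have hpow : (2 : ℝ) ^ m * (4 * 4 ^ k) ^ m * (64 * R) ^ k = 8 ^ m * (4 ^ m * (64 * R)) ^ k := by
    have e1 : ((4 : ℝ) * 4 ^ k) ^ m = 4 ^ m * 4 ^ (k * m) := by rw [mul_pow, ← pow_mul]
    have e2 : ((4 : ℝ) ^ m * (64 * R)) ^ k = 4 ^ (k * m) * (64 * R) ^ k := by
      rw [mul_pow, ← pow_mul, mul_comm m k]
    have e3 : (8 : ℝ) ^ m = 2 ^ m * 4 ^ m := by rw [← mul_pow]; norm_num
    rw [e1, e2, e3]; ring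
  refine le_of_eq ?_
  calc (2 : ℝ) ^ m * ((4 * 4 ^ k) ^ m * wt k τ₁ * ((m.factorial : ℝ) * ((k : ℝ) + 1) ^ 2 * (64 * R) ^ k))
      = (2 ^ m * (4 * 4 ^ k) ^ m * (64 * R) ^ k) * ((m.factorial : ℝ) * (wt k τ₁ * ((k : ℝ) + 1) ^ 2)) := by
        ring
    _ = (8 ^ m * (4 ^ m * (64 * R)) ^ k) * ((m.factorial : ℝ) * (wt k τ₁ * ((k : ℝ) + 1) ^ 2)) := by
        rw [hpow]
    _ = _ := by ring

/-- **The majorant in closed Gaussian form**: for `y.1 ≥ τ₁`, `|y.2| ≤ R`, `R ≥ 1`,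
`‖D^m [(τ, s) ↦ wt k τ · C_k(s)] (y)‖ ≤ 8^m m! · e^{-k(k+3)τ₁} (4^m · 512 R)^k`
(`(2k+3)/3 · (k+1)² ≤ 8^k`). [folklore] -/
theorem norm_iteratedFDeriv_mode_le_exp (m k : ℕ) {τ₁ R : ℝ} (hR : 1 ≤ R) {y : ℝ × ℝ}
    (hy1 : τ₁ ≤ y.1) (hy2 : |y.2| ≤ R) :
    ‖iteratedFDeriv ℝ m (fun y : ℝ × ℝ => wt k y.1 * gegen k y.2) y‖ ≤
      (8 ^ m * (m.factorial : ℝ)) *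
        (Real.exp (-((k : ℝ) * ((k : ℝ) + 3)) * τ₁) * (4 ^ m * (512 * R)) ^ k) := by
  refine (norm_iteratedFDeriv_mode_le m k hR hy1 hy2).trans ?_
  refine mul_le_mul_of_nonneg_left ?_ (by positivity)
  rw [wt]
  have h8 := wtPoly_le_eight_pow k
  have hsplit : ((4 : ℝ) ^ m * (512 * R)) ^ k = 8 ^ k * (4 ^ m * (64 * R)) ^ k := by
    rw [← mul_pow]; ring
  rw [hsplit]
  have hE := Real.exp_pos (-((k : ℝ) * ((k : ℝ) + 3)) * τ₁)
  have hP : (0 : ℝ) ≤ (4 ^ m * (64 * R)) ^ k := by positivity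
  calc Real.exp (-((k : ℝ) * ((k : ℝ) + 3)) * τ₁) * ((2 * (k : ℝ) + 3) / 3) * ((k : ℝ) + 1) ^ 2 *
        (4 ^ m * (64 * R)) ^ k
      = Real.exp (-((k : ℝ) * ((k : ℝ) + 3)) * τ₁) *
          (((2 * (k : ℝ) + 3) / 3 * ((k : ℝ) + 1) ^ 2) * (4 ^ m * (64 * R)) ^ k) := by ring
    _ ≤ Real.exp (-((k : ℝ) * ((k : ℝ) + 3)) * τ₁) * (8 ^ k * (4 ^ m * (64 * R)) ^ k) :=
        mul_le_mul_of_nonneg_left (mul_le_mul_of_nonneg_right h8 hP) hE.le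

/-- The closed-form majorant is summable in `k` for every order `m`, `τ₁ > 0`. [folklore] -/
theorem summable_mode_majorant (m : ℕ) {τ₁ : ℝ} (hτ₁ : 0 < τ₁) {R : ℝ} (hR : 0 ≤ R) :
    Summable fun k : ℕ => (8 ^ m * (m.factorial : ℝ)) *
      (Real.exp (-((k : ℝ) * ((k : ℝ) + 3)) * τ₁) * (4 ^ m * (512 * R)) ^ k) :=
  (summable_exp_mul_pow_of_pos hτ₁ (C := 4 ^ m * (512 * R)) (by positivity)).mul_left _

end Literature.Geometry.Riemannian.SphericalCylinderEntropy

end
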